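import Summits.Parity.GeneralizedHardyLittlewood.Theorems.LeeYangFibresRelativeDimOneFloatingDefs
import Summits.Parity.GeneralizedHardyLittlewood.Theorems.LeeYangFibresRelativeDimOneTypeData
import HarnessLib

/-!
# Route `LeeYangFibres`, crux `RelativeDimOne` (stmt-Parity-14113), line `floating-level-core`:
# `stub_typeDataFlat` — the type data with the conditioning depth chosen AFTER the accuracy

`stub_typeDataFlat : TypeClassMomentsFlat → SingularWeightFacts → TypeRigidity → TypeDataFlat θ` for every
`0 < θ < 1` — a RE-THREAD of the landed `stub_typeData` (`Theorems/LeeYangFibresRelativeDimOneTypeData.lean`).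
In that proof the type-class moving moments are consumed exactly ONCE, at the level-INDEPENDENT data
`(t, (2L+2)^t + L + 1, δ = 1, ε = η/16)`, and the level `θ₁` enters only the depth threshold
`D₀ = ⌈1/θ₁⌉ + ⌈2/(1−θ)⌉ + 1` (through `∏_{p ≤ w} p ≤ N^{1/D} ≤ N^{θ₁}`, `w = ⌊log₄ N⌋ / D`). With the flat moments
`TypeClassMomentsFlat` (`∀ t L δ ε ∃ θ₁ > 0 ∃ N₀ …`) the level is PRODUCED once `(C, η)` are given, whence the flat
order `∀ t L ∃ L₁ ∀ C η ∃ D₀ ∀ D ≥ D₀ ∃ ε ∃ N₀` of `TypeDataFlat θ`. The body of the proof — prime side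
`TypeDataProof.prime_side` (dictionary identity + moments at the cell modulus + (W5)), spectrum side
`TypeDataProof.spectrum_side` (residue counting on the type cell), `TypeDataProof.cell_count_le`, the summed core
clause `TypeDataProof.core_summed` and the real arithmetic `TypeDataProof.combine` — is unchanged and referenced by
name.

References: Green–Tao, Ann. of Math. 171 (2010), Conj. 1.4 [GreenTao2010]; Gallagher, Mathematika 23 (1976) §2
[Gallagher1976].
-/

noncomputable section

open scoped BigOperators Classical ArithmeticFunction.vonMangoldt
open Finset Filter Literature.NumberTheory.Sieve
open Summit.Parity.GeneralizedHardyLittlewood.Cruxes.RelativeDimOne.GallagherBackwards (classPsi)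
open Summit.Parity.GeneralizedHardyLittlewood.Cruxes.RelativeDimOne.GallagherBackwardsSplit
open Summit.Parity.GeneralizedHardyLittlewood.Cruxes.RelativeDimOne.TypeSplit
open Summit.Parity.GeneralizedHardyLittlewood.Cruxes.RelativeDimOne.TypeSplit.TypeDataProof

namespace Summit.Parity.GeneralizedHardyLittlewood.Cruxes.RelativeDimOne.FloatingLevelCore

/-- **The flat type data** (`TypeDataFlat θ`, `0 < θ < 1`) from the flat type-class moving moments, the
singular-weight facts (W5) and type rigidity (R3). Given `t, L` put `L₁ = t((2L+2)^t + L + 1)`; given `C, η` apply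
`TypeClassMomentsFlat` at `(t, (2L+2)^t + L + 1, δ = 1, ε = η/16)` to obtain a level `θ₁ > 0` and a threshold `N₁`;
put `D₀ = ⌈1/θ₁⌉ + ⌈2/(1−θ)⌉ + 1`; for `D ≥ D₀` take `ε = η/(2^{t+3}(C+1))`, `N₂` from `TypeRigidity` at
`(t, L, D, C, 1)` and `N₃` with `N^{−(1−θ)/2} ≤ η/(4(t 2^{t+1} C + 1))`, `N ≥ 4/η + 2` beyond it. For `N ≥ N₁+N₂+N₃+2`
the cell modulus `P = ∏_{p ≤ w} p` is squarefree with `P ≤ N^{1/D} ≤ N^{θ₁}` and `⌊N^θ⌋ P ≤ (N+1) N^{−(1−θ)/2}`;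
the prime side, the spectrum side, the cell count and the summed core clause are combined by `combine`. -/
theorem stub_typeDataFlat :
    ∀ θ : ℝ, 0 < θ → θ < 1 → TypeClassMomentsFlat → SingularWeightFacts → TypeRigidity → TypeDataFlat θ := by
  intro θ hθ hθ1 hTCM hSWF hTR t L ht
  obtain ⟨-, -, -, hW5⟩ := hSWF
  refine ⟨t * ((2 * L + 2) ^ t + L + 1), ?_, ?_⟩
  · calc L ≤ (2 * L + 2) ^ t + L + 1 := by omega
      _ = 1 * ((2 * L + 2) ^ t + L + 1) := (one_mul _).symm
      _ ≤ t * ((2 * L + 2) ^ t + L + 1) := Nat.mul_le_mul_right _ ht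
  intro C η hC hη
  -- the type-class moving moments, consumed ONCE at level-independent data: this PRODUCES the level `θ₁`
  obtain ⟨θ₁, hθ₁, N₁, hN₁⟩ := hTCM t ((2 * L + 2) ^ t + L + 1) ht 1 (η / 16) one_pos (by positivity)
  -- the depth threshold
  refine ⟨⌈1 / θ₁⌉₊ + ⌈2 / (1 - θ)⌉₊ + 1, ?_⟩
  intro D hD
  have hD1 : 1 ≤ D := le_trans (Nat.le_add_left 1 _) hD
  have hDpos : (0 : ℝ) < D := by exact_mod_cast hD1
  have hDθ₁ : 1 / (D : ℝ) ≤ θ₁ := by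
    have h1 : (⌈1 / θ₁⌉₊ : ℝ) ≤ D := by exact_mod_cast (show ⌈1 / θ₁⌉₊ ≤ D by omega)
    have h2 : 1 / θ₁ ≤ (⌈1 / θ₁⌉₊ : ℝ) := Nat.le_ceil _
    have h3 : 1 / θ₁ ≤ D := h2.trans h1
    rw [div_le_iff₀ hθ₁] at h3
    rw [div_le_iff₀ hDpos]
    linarith
  have hDθ : 1 / (D : ℝ) ≤ (1 - θ) / 2 := by
    have h1 : (⌈2 / (1 - θ)⌉₊ : ℝ) ≤ D := by exact_mod_cast (show ⌈2 / (1 - θ)⌉₊ ≤ D by omega)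
    have h2 : 2 / (1 - θ) ≤ (⌈2 / (1 - θ)⌉₊ : ℝ) := Nat.le_ceil _
    have h3 : 2 / (1 - θ) ≤ D := h2.trans h1
    rw [div_le_iff₀ (by linarith)] at h3
    rw [div_le_iff₀ hDpos]
    linarith
  -- the accuracy asked of the core
  refine ⟨η / (2 ^ (t + 3) * (C + 1)), by positivity, ?_⟩
  -- thresholds
  obtain ⟨N₂, hN₂⟩ := hTR t L D C 1 ht hD1 hC one_pos
  have hγ : 0 < (1 - θ) / 2 := by linarith
  have hcpos : 0 < η / (4 * (t * 2 ^ (t + 1) * C + 1)) := by positivity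
  have hev : ∀ᶠ N : ℕ in atTop,
      (N : ℝ) ^ (-((1 - θ) / 2)) ≤ η / (4 * (t * 2 ^ (t + 1) * C + 1)) ∧ 4 / η + 2 ≤ (N : ℝ) :=
    (((tendsto_rpow_neg_atTop hγ).comp tendsto_natCast_atTop_atTop).eventually_le_const hcpos).and
      (tendsto_natCast_atTop_atTop.eventually_ge_atTop _)
  obtain ⟨N₃, hN₃⟩ := Filter.eventually_atTop.1 hev
  refine ⟨N₁ + N₂ + N₃ + 2, ?_⟩
  intro N hN f hTI hHD hCore a b₀ ha hb₀ hnd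
  have hNN₁ : N₁ ≤ N := by omega
  have hNN₂ : N₂ ≤ N := by omega
  have hN1 : 1 ≤ N := by omega
  obtain ⟨hNc, hNη⟩ := hN₃ N (by omega)
  have hNr1 : (1 : ℝ) ≤ N := by exact_mod_cast hN1
  have hNr2 : (2 : ℝ) ≤ N := by exact_mod_cast (show 2 ≤ N by omega)
  -- the cell modulus and the level
  have hP0 : 0 < primorial (wlev D N) := primorial_pos _
  have hPsq : Squarefree (primorial (wlev D N)) := squarefree_primorial _
  have hPθ₁ : ((primorial (wlev D N) : ℕ) : ℝ) ≤ (N : ℝ) ^ θ₁ :=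
    (primorial_wlev_le_rpow hN1 hD1).trans (Real.rpow_le_rpow_of_exponent_le hNr1 hDθ₁)
  have hPr : (0 : ℝ) < ((primorial (wlev D N) : ℕ) : ℝ) := by exact_mod_cast hP0
  have hx1 : (1 : ℝ) ≤ (((N + 1 : ℕ)) : ℝ) / (primorial (wlev D N) : ℕ) := by
    rw [le_div_iff₀ hPr, one_mul]
    exact_mod_cast (primorial_wlev_le hN1 hD1).trans (Nat.le_succ N)
  have hQP := level_mul_primorial_le (θ := θ) hN1 hD1 hDθ
  have hNγ1 : (N : ℝ) ^ (-((1 - θ) / 2)) ≤ 1 :=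
    Real.rpow_le_one_of_one_le_of_nonpos hNr1 (by linarith)
  have hQx : ((level θ N : ℕ) : ℝ) ≤ (((N + 1 : ℕ)) : ℝ) / (primorial (wlev D N) : ℕ) := by
    rw [le_div_iff₀ hPr]
    calc ((level θ N : ℕ) : ℝ) * ((primorial (wlev D N) : ℕ) : ℝ)
        ≤ (((N + 1 : ℕ)) : ℝ) * (N : ℝ) ^ (-((1 - θ) / 2)) := hQP
      _ ≤ (((N + 1 : ℕ)) : ℝ) * 1 := by gcongr
      _ = _ := mul_one _
  have hδ : (t : ℝ) * 2 ^ (t + 1) * C * ((level θ N : ℕ) : ℝ) ≤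
      η / 4 * ((((N + 1 : ℕ)) : ℝ) / (primorial (wlev D N) : ℕ)) := by
    have hQc : ((level θ N : ℕ) : ℝ) ≤
        η / (4 * (t * 2 ^ (t + 1) * C + 1)) * ((((N + 1 : ℕ)) : ℝ) / (primorial (wlev D N) : ℕ)) := by
      rw [← mul_div_assoc, le_div_iff₀ hPr]
      calc ((level θ N : ℕ) : ℝ) * ((primorial (wlev D N) : ℕ) : ℝ)
          ≤ (((N + 1 : ℕ)) : ℝ) * (N : ℝ) ^ (-((1 - θ) / 2)) := hQP
        _ ≤ (((N + 1 : ℕ)) : ℝ) * (η / (4 * (t * 2 ^ (t + 1) * C + 1))) := by gcongr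
        _ = _ := mul_comm _ _
    have hA : (t : ℝ) * 2 ^ (t + 1) * C * (η / (4 * (t * 2 ^ (t + 1) * C + 1))) ≤ η / 4 := by
      rw [show (t : ℝ) * 2 ^ (t + 1) * C * (η / (4 * (t * 2 ^ (t + 1) * C + 1)))
          = η / 4 * ((t * 2 ^ (t + 1) * C) / (t * 2 ^ (t + 1) * C + 1)) by field_simp]
      have h1 : ((t : ℝ) * 2 ^ (t + 1) * C) / (t * 2 ^ (t + 1) * C + 1) ≤ 1 :=
        (div_le_one (by positivity)).2 (by linarith)
      calc η / 4 * ((t * 2 ^ (t + 1) * C) / (t * 2 ^ (t + 1) * C + 1)) ≤ η / 4 * 1 := by gcongr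
        _ = η / 4 := mul_one _
    calc (t : ℝ) * 2 ^ (t + 1) * C * ((level θ N : ℕ) : ℝ)
        ≤ (t : ℝ) * 2 ^ (t + 1) * C *
            (η / (4 * (t * 2 ^ (t + 1) * C + 1)) * ((((N + 1 : ℕ)) : ℝ) / (primorial (wlev D N) : ℕ))) :=
          mul_le_mul_of_nonneg_left hQc (by positivity)
      _ = (t : ℝ) * 2 ^ (t + 1) * C * (η / (4 * (t * 2 ^ (t + 1) * C + 1))) *
            ((((N + 1 : ℕ)) : ℝ) / (primorial (wlev D N) : ℕ)) := by ring
      _ ≤ η / 4 * ((((N + 1 : ℕ)) : ℝ) / (primorial (wlev D N) : ℕ)) :=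
          mul_le_mul_of_nonneg_right hA (by positivity)
  -- the five inputs (`hN₁ N hNN₁ : TypeClassMomentsAt …` unfolds definitionally to the landed moments' body)
  have h1 := prime_side (t := t) hP0 hPsq hPθ₁ (hN₁ N hNN₁) hW5 ha b₀
  rw [localTypeFactor_primorial] at h1
  obtain ⟨h2, h3⟩ := spectrum_side L N (wlev D N) (level θ N) b₀ (hTI a)
  have h4 := cell_count_le (L := L) (N := N) hP0 a b₀
  have h5 := core_summed (θ := θ) hN1 hCore ha _
    (Finset.filter_subset (fun b => ∀ p ∈ (primorial (wlev D N)).primeFactors,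
      incType p a b = incType p a b₀) _)
  have hR3 := (hN₂ N hNN₂ (level θ N) a ha (f a) (hTI a) (hHD a) b₀ hb₀ hnd).2.2
  -- combine
  have hK : (0 : ℝ) < ((typeCell (primorial (wlev D N)) (primorial (wlev D N)) a b₀).card : ℝ) := by
    exact_mod_cast typeCell_self_card_pos hP0 a b₀
  have hR0 : 0 ≤ ∑ q ∈ (Finset.Icc 1 (level θ N)).filter Squarefree,
      condAvg q (wlev D N) a b₀ (fun b => |f a q b|) :=
    Finset.sum_nonneg fun q _ => condAvg_abs_nonneg q _ a b₀ _
  have hNη' : 4 ≤ η * ((N : ℝ) - 1) := by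
    have h1 : 4 / η ≤ (N : ℝ) - 1 := by linarith
    rw [div_le_iff₀ hη] at h1
    linarith
  exact combine ht hK hx1 (Nat.cast_nonneg _) hQx hNr2 (by positivity) (by positivity)
    (EndgameProof.one_le_gscale _ a b₀) (singularProductPartial_nonneg _ a b₀)
    (singularProductPartial_le_gscale _ a b₀) hR0 (by linarith [hR3]) h1 h2 h3 h4 h5
    (le_of_eq (by field_simp; ring)) hδ hNη' (le_of_eq (by ring))

end Summit.Parity.GeneralizedHardyLittlewood.Cruxes.RelativeDimOne.FloatingLevelCore

end
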